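import Summits.Ventures.Crystal3D.Theorems.StickyWulffConstantPolycrystalWulffBoundRadialMass
import Summits.Ventures.Crystal3D.Theorems.StickyWulffConstantPolycrystalWulffBoundWulffOverlapHyps
import Summits.Ventures.Crystal3D.Theorems.StickyWulffConstantPolycrystalWulffBoundTwoClassArith

/-!
# `PolycrystalWulffBound`, line `PolyDensity`: an UNCONDITIONAL Wulff-body overlap constant
# `|W(1) ∩ W(R)| ≥ 26.61` for every `R`, and the two-class arithmetic at wall charge `6/5`
# (crux `stmt-Ventures-19482`; lane poly-p2, gen 23)

Route `StickyWulffConstant` of the venture `Summits/Ventures/Crystal3D`, second prover lane.  The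
middle-band rungs of line `PolyDensity` take the pairwise overlap constant of the fcc Wulff body as a
computational hypothesis (CH-P1 `WulffOverlap27_5`, CH-P1′ `WulffOverlap27_8`; true minimum `27.9013`,
certified numerically, not proved in the kernel).  This file proves a WEAKER constant with no
hypothesis at all:

* `wulffPairOverlap_cap` : **`WulffPairOverlap 26.61`** — for every linear isometry `R`,
  `26.61 ≤ |W(1) ∩ W(R)|`.  Proof: both bodies have mass `≥ π(24√3 − 32) ≈ 30.06` inside the ball
  `B̄(0,2)` (`volume_cruxWulffBody_inter_closedBall_two_ge`, poly-p2 g15: in cubic coordinates a point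
  of `B̄(0,2)` outside `W` lies in one of the eight ball caps beyond the hexagonal facets), and
  `|B̄(0,2)| = 32π/3`; inclusion–exclusion inside the ball gives
  `|W(1) ∩ W(R)| ≥ 2π(24√3 − 32) − 32π/3 = π(48√3 − 224/3) = 26.614…`.
* `twoClass_arith_charged` : the balanced-case arithmetic of the two-class rung
  (`twoClass_arith`, g3) re-run with the overlap constant `26.61` and generic walls charged `≥ 6/5`
  (instead of `27.5` and `≥ 1`): from `3·V_K^{1/3}·V^{2/3} + (3/5)·D ≤ En`,
  `w(v₁) + w(v₂) − (√5 − 3/5)·D ≤ En`, `V_K ≥ 26.61` and both classes `≥ (3/20)·V` conclude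
  `w(V) ≤ En` (margin `0.4 %`).

These are the two inputs of the UNCONDITIONAL two-class rung at charge `6/5`
(`…RungTwinFreeTwoClassesCharged`): the crux's wall law `c₀ = 1` is within `20 %` of a certificate-free
kernel theorem on two-lattice textures, and CH-P1 buys exactly the last `20 %` of wall charge.
WHAT THIS IS NOT: the constant `27.5` (that needs the direction-resolved overlap, a certified computation);
anything about textures by itself; the crux is not claimed.
-/

noncomputable section

open scoped BigOperators InnerProductSpace ENNReal
open MeasureTheory Set

namespace Summit.Ventures.Crystal3D.Cruxes.PolycrystalWulffBound.PolyDensity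

open Summit.Ventures.Crystal3D.Theorems
open Summit.Ventures.Crystal3D.Cruxes.TextureLiminf.TexShadow (E3)

/-! ### Decimal brackets -/

/-- `1.73205 ≤ √3`. -/
theorem sqrt_three_lower_fine : (1.73205 : ℝ) ≤ Real.sqrt 3 := by
  rw [show (1.73205 : ℝ) = Real.sqrt (1.73205 ^ 2) by rw [Real.sqrt_sq (by norm_num)]]
  exact Real.sqrt_le_sqrt (by norm_num)

/-- The cap constant exceeds `26.61`: `26.61 ≤ 2·π(24√3 − 32) − (4/3)·π·2³ = π(48√3 − 224/3)`. -/
theorem capOverlap_const_ge :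
    (26.61 : ℝ) ≤ 2 * (Real.pi * (24 * Real.sqrt 3 - 32)) - 4 / 3 * Real.pi * 2 ^ 3 := by
  have h3 := sqrt_three_lower_fine
  have hπ := Real.pi_gt_d6
  have hπ4 := Real.pi_lt_d2
  nlinarith [mul_le_mul_of_nonneg_left h3 (le_of_lt Real.pi_pos)]

/-! ### The unconditional overlap constant -/

open Literature.MathematicalPhysics.StatisticalMechanics (fccStacking) in
/-- **Unconditional pairwise overlap of two fcc Wulff bodies: `26.61 ≤ |W(A) ∩ W(B)|`** for every pair
of frames.  Each body has mass `≥ π(24√3 − 32)` in `B̄(0,2)` and `|B̄(0,2)| = 32π/3`, so by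
inclusion–exclusion inside the ball the two bodies share at least `2π(24√3 − 32) − 32π/3 ≈ 26.61` of
volume. -/
theorem volume_cruxWulffBody_inter_ge_cap (A B : E3 ≃ₗᵢ[ℝ] E3) :
    (26.61 : ℝ) ≤ (volume
      ({y : E3 | ∀ ν : E3, ⟪y, ν⟫_ℝ ≤ Real.sqrt 2 / 4 *
          ∑ᶠ w ∈ {w | w ∈ fccStacking 1 (Real.sqrt (2 / 3)) ∧ ‖w‖ = 1}, |⟪w, A.symm ν⟫_ℝ|} ∩
       {y : E3 | ∀ ν : E3, ⟪y, ν⟫_ℝ ≤ Real.sqrt 2 / 4 *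
          ∑ᶠ w ∈ {w | w ∈ fccStacking 1 (Real.sqrt (2 / 3)) ∧ ‖w‖ = 1}, |⟪w, B.symm ν⟫_ℝ|})).toReal := by
  set W₁ : Set E3 := {y : E3 | ∀ ν : E3, ⟪y, ν⟫_ℝ ≤ Real.sqrt 2 / 4 *
      ∑ᶠ w ∈ {w | w ∈ fccStacking 1 (Real.sqrt (2 / 3)) ∧ ‖w‖ = 1}, |⟪w, A.symm ν⟫_ℝ|} with hW₁
  set W₂ : Set E3 := {y : E3 | ∀ ν : E3, ⟪y, ν⟫_ℝ ≤ Real.sqrt 2 / 4 *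
      ∑ᶠ w ∈ {w | w ∈ fccStacking 1 (Real.sqrt (2 / 3)) ∧ ‖w‖ = 1}, |⟪w, B.symm ν⟫_ℝ|} with hW₂
  set Bl : Set E3 := Metric.closedBall (0 : E3) 2 with hBl
  -- masses inside the ball
  have hK₁ : ENNReal.ofReal (Real.pi * (24 * Real.sqrt 3 - 32)) ≤ volume (W₁ ∩ Bl) :=
    volume_cruxWulffBody_inter_closedBall_two_ge A
  have hK₂ : ENNReal.ofReal (Real.pi * (24 * Real.sqrt 3 - 32)) ≤ volume (W₂ ∩ Bl) :=
    volume_cruxWulffBody_inter_closedBall_two_ge B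
  have hBvol : volume Bl = ENNReal.ofReal (4 / 3 * Real.pi * 2 ^ 3) :=
    volume_closedBall_zero_E3 (by norm_num)
  -- inclusion–exclusion inside the ball
  have hmeas₂ : MeasurableSet (W₂ ∩ Bl) :=
    (isCompact_cruxWulffBody B).measurableSet.inter Metric.isClosed_closedBall.measurableSet
  have hIE : volume (W₁ ∩ Bl ∪ W₂ ∩ Bl) + volume (W₁ ∩ Bl ∩ (W₂ ∩ Bl)) =
      volume (W₁ ∩ Bl) + volume (W₂ ∩ Bl) := measure_union_add_inter _ hmeas₂
  have hU : volume (W₁ ∩ Bl ∪ W₂ ∩ Bl) ≤ ENNReal.ofReal (4 / 3 * Real.pi * 2 ^ 3) := by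
    rw [← hBvol]
    exact measure_mono (union_subset inter_subset_right inter_subset_right)
  have hsub : W₁ ∩ Bl ∩ (W₂ ∩ Bl) ⊆ W₁ ∩ W₂ := fun y hy => ⟨hy.1.1, hy.2.1⟩
  have ha0 : 0 ≤ Real.pi * (24 * Real.sqrt 3 - 32) := by
    have h3 := sqrt_three_lower_fine
    have : (0 : ℝ) ≤ 24 * Real.sqrt 3 - 32 := by linarith
    exact mul_nonneg Real.pi_pos.le this
  have hb0 : (0 : ℝ) ≤ 4 / 3 * Real.pi * 2 ^ 3 := by positivity
  have hlow : ENNReal.ofReal (2 * (Real.pi * (24 * Real.sqrt 3 - 32)) - 4 / 3 * Real.pi * 2 ^ 3) ≤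
      volume (W₁ ∩ W₂) := by
    refine le_trans ?_ (measure_mono hsub)
    rw [ENNReal.ofReal_sub _ hb0]
    refine tsub_le_iff_right.2 ?_
    have h2a : ENNReal.ofReal (2 * (Real.pi * (24 * Real.sqrt 3 - 32))) ≤
        volume (W₁ ∩ Bl) + volume (W₂ ∩ Bl) := by
      rw [two_mul, ENNReal.ofReal_add ha0 ha0]
      exact add_le_add hK₁ hK₂
    calc ENNReal.ofReal (2 * (Real.pi * (24 * Real.sqrt 3 - 32)))
        ≤ volume (W₁ ∩ Bl) + volume (W₂ ∩ Bl) := h2a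
      _ = volume (W₁ ∩ Bl ∪ W₂ ∩ Bl) + volume (W₁ ∩ Bl ∩ (W₂ ∩ Bl)) := hIE.symm
      _ ≤ ENNReal.ofReal (4 / 3 * Real.pi * 2 ^ 3) + volume (W₁ ∩ Bl ∩ (W₂ ∩ Bl)) := by
          gcongr
      _ = volume (W₁ ∩ Bl ∩ (W₂ ∩ Bl)) + ENNReal.ofReal (4 / 3 * Real.pi * 2 ^ 3) := add_comm _ _
  -- finiteness and the real form
  have hfin : volume (W₁ ∩ W₂) ≠ ⊤ :=
    (lt_of_le_of_lt (measure_mono inter_subset_left) (isCompact_cruxWulffBody A).measure_lt_top).ne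
  have hreal := (ENNReal.ofReal_le_iff_le_toReal hfin).1 hlow
  exact le_trans capOverlap_const_ge hreal

/-- **`WulffPairOverlap 26.61`, unconditionally**: for every linear isometry `R` of `ℝ³`,
`26.61 ≤ |W(1) ∩ W(R)|` (the pair form with `A = 1`, `B = R`). -/
theorem wulffPairOverlap_cap : WulffPairOverlap 26.61 := by
  unfold WulffPairOverlap
  intro Λ Φ W R
  exact volume_cruxWulffBody_inter_ge_cap (LinearIsometryEquiv.refl ℝ E3) R

/-! ### The balanced-case arithmetic at overlap `26.61` and wall charge `6/5` -/

/-- **Two-class corner at charge `6/5` (arithmetic).**  Let `V = v₁ + v₂` with both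
`v_i ≥ (3/20)·V`, `V_K ≥ 26.61`, `D ≥ 0`, and an energy `En` with
`3·V_K^{1/3}·V^{2/3} + (3/5)·D ≤ En` (intersection-body bound plus generic walls charged `≥ 6/5`) and
`w(v₁) + w(v₂) − (√5 − 3/5)·D ≤ En` (second pincer), `w(v) = 6·2^{1/3}(√2 v)^{2/3}`.  Then
`w(V) ≤ En` (eliminate `D` with weights `√5 − 3/5 : 3/5`; margin `0.4 %`). -/
theorem twoClass_arith_charged {V v₁ v₂ VK D En : ℝ} (hV : V = v₁ + v₂) (h1 : 3 / 20 * V ≤ v₁)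
    (h2 : 3 / 20 * V ≤ v₂) (hVK : (26.61 : ℝ) ≤ VK) (hD : 0 ≤ D)
    (hK : 3 * VK ^ ((1 : ℝ) / 3) * V ^ ((2 : ℝ) / 3) + 3 / 5 * D ≤ En)
    (hP : 6 * (2 : ℝ) ^ ((1 : ℝ) / 3) * (Real.sqrt 2 * v₁) ^ ((2 : ℝ) / 3) +
      6 * (2 : ℝ) ^ ((1 : ℝ) / 3) * (Real.sqrt 2 * v₂) ^ ((2 : ℝ) / 3) -
        (Real.sqrt 5 - 3 / 5) * D ≤ En) :
    6 * (2 : ℝ) ^ ((1 : ℝ) / 3) * (Real.sqrt 2 * V) ^ ((2 : ℝ) / 3) ≤ En := by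
  have hV0 : 0 ≤ V := by nlinarith
  have hv1 : 0 ≤ v₁ := le_trans (by positivity) h1
  have hv2 : 0 ≤ v₂ := le_trans (by positivity) h2
  rw [wulffConstant_eq' hV0]
  rw [wulffConstant_eq' hv1, wulffConstant_eq' hv2] at hP
  obtain ⟨ht1, ht2, -⟩ := cbrt_two_bounds
  set t : ℝ := (2 : ℝ) ^ ((1 : ℝ) / 3) with ht
  have ht0 : 0 ≤ t := by positivity
  -- the concavity step
  have hkey := rpow_two_thirds_two_classes hV h1 h2
  have h17 := rpow_seventeen_twentieths_lower
  have h3 := rpow_three_twentieths_lower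
  set W : ℝ := V ^ ((2 : ℝ) / 3) with hW
  set W1 : ℝ := v₁ ^ ((2 : ℝ) / 3) with hW1
  set W2 : ℝ := v₂ ^ ((2 : ℝ) / 3) with hW2
  have hW0 : 0 ≤ W := by positivity
  have hW10 : 0 ≤ W1 := by positivity
  have hW20 : 0 ≤ W2 := by positivity
  have hsum : (1.1796 : ℝ) * W ≤ W1 + W2 := by nlinarith [hkey, h17, h3, hW0]
  -- the cube root of `V_K`
  have hcbrt : (2.985 : ℝ) ≤ VK ^ ((1 : ℝ) / 3) :=
    le_rpow_third_of_cube_le (by norm_num) (le_trans (by norm_num) hVK)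
  -- decimal brackets
  have h5l : (2.236 : ℝ) ≤ Real.sqrt 5 := sqrt_five_lower'
  have h5u : Real.sqrt 5 ≤ (2.2361 : ℝ) := sqrt_five_upper
  have ht2l : (1.2599 : ℝ) ^ 2 ≤ t ^ 2 := by gcongr
  have ht2u : t ^ 2 ≤ (1.25993 : ℝ) ^ 2 := by gcongr
  -- products, as linear facts
  have p1 : (2.985 : ℝ) * W ≤ VK ^ ((1 : ℝ) / 3) * W := mul_le_mul_of_nonneg_right hcbrt hW0
  have p2 : (1.2599 : ℝ) ^ 2 * (W1 + W2) ≤ t ^ 2 * (W1 + W2) :=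
    mul_le_mul_of_nonneg_right ht2l (by positivity)
  have p3 : t ^ 2 * W ≤ (1.25993 : ℝ) ^ 2 * W := mul_le_mul_of_nonneg_right ht2u hW0
  have p4 : (Real.sqrt 5 - 3 / 5) * D ≤ (2.2361 - 3 / 5) * D :=
    mul_le_mul_of_nonneg_right (by linarith) hD
  -- eliminate `D` with weights `1.6361 : 0.6`
  nlinarith [hK, hP, p1, p2, p3, p4, hsum, hD, hW0, hW10, hW20, sq_nonneg t]

end Summit.Ventures.Crystal3D.Cruxes.PolycrystalWulffBound.PolyDensity

end
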